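import Literature.NumberTheory.IwasawaTheory.Greenberg2016.CoefficientLevels
import Literature.NumberTheory.IwasawaTheory.Greenberg2016.RestrictedRamificationBridge
import Literature.NumberTheory.GaloisCohomology.RestrictedRamificationUnramifiedClasses
import HarnessLib

/-!
# Level lifts of the classes of `H¹(K_Σ/K, 𝐃)`, unramified outside `Σ`, read on the `Γ_K`-side
# (theorems only)

Topic `NumberTheory/IwasawaTheory/Greenberg2016`; namespace
`Literature.NumberTheory.IwasawaTheory.Greenberg2016`; THEOREMS ONLY (no definition, no named fact,
no `sorry`, no instance).  Lane «SUR-Λ» of cell `bsd-eis` (road memo `SUR-LAMBDA-ROAD-w5g9.md`, the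
hypothesis `hlift`/`hx`,`hxk` of `DualSelmerCokernelPairing.globalFunctional_phi_eq_zero`, brick C5c
part 3), `--supports stmt-BirchSwinnertonDyer-19032`.

For `ρ : ContinuousRep (GaloisGroupUnramifiedOutside K S) Λ 𝐃` (`𝐃` discrete) and a directed
exhaustive family `N : ι → Submodule Λ 𝐃` of `Gal(K_Σ/K)`-stable submodules, every class
`x ∈ H¹(K_Σ/K, 𝐃) = ρ.H 1` comes from some `H¹(K_Σ/K, N i)` (the tree's
`exists_Hmap_subtype_eq_one`, `CoefficientLevels.lean`); read on the `Γ_K`-side through the bridge of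
`RestrictedRamificationBridge.lean` (`restrictedHAddEquiv`, `toGaloisModule`, `toGaloisModuleHom`)
this says: **the inflation `inf x ∈ H¹(Γ_K, 𝐃)` of `x` is the image of the inflation of a class
`c ∈ H¹(G_Σ, (N i)^{N_Σ})` of the level `N i`** (`exists_level_restrictedInf_eq`), and that level-`i`
class `inf c ∈ H¹(Γ_K, N i)` is UNRAMIFIED at every finite `v ∉ Σ` (the tree's
`localization_mem_unramifiedSubgroup_of_mem_range_restrictedInf`; restated as
`localization_restrictedInf_mem_unramifiedSubgroup`).  This is the "lift `x` through a finite level,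
unramified off `Σ` by construction" used in Greenberg 2010 §3.1 when the Poitou–Tate sum formula is
applied at a finite level (`TateDualLimitPairingSumFormula.lean`).  The one new ingredient is the
square `inf ∘ H¹(G_Σ, u|) = H¹(Γ_K, u) ∘ inf` for a coefficient map `u` (`restrictedInf_map_invariantsHom`,
degree `1`, cocycle level).

HONESTY: plumbing; nothing about Poitou–Tate, Greenberg's propositions or BSD is proved here.  AI
formalisation, weaker than expert review; the statements are established only by the kernel check.

## References
* R. Greenberg, *Surjectivity of the global-to-local map defining a Selmer group*, Kyoto J. Math.
  50 (2010) 853–888, §3.1 p. 14. [Greenberg2010]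
* J. S. Milne, *Arithmetic Duality Theorems*, 2nd ed. (2006), I §4 (p. 55), Lemma 4.8. [MilneADT2006]
-/

noncomputable section

open Function CategoryTheory NumberField IsDedekindDomain Field
open _root_.TopRep _root_.ContRepresentation _root_.ContinuousCohomology
open Literature.NumberTheory.GaloisRepresentations
open Literature.NumberTheory.GaloisRepresentations.DiscreteGaloisModule

namespace Literature.NumberTheory.IwasawaTheory.Greenberg2016

variable {K : Type} [Field K] [NumberField K] (S : Set (HeightOneSpectrum (𝓞 K)))
  {Λ : Type} [CommRing Λ] [TopologicalSpace Λ]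
  {A B : Type} [AddCommGroup A] [Module Λ A] [TopologicalSpace A] [DiscreteTopology A]
  [ContinuousSMul Λ A] [AddCommGroup B] [Module Λ B] [TopologicalSpace B] [DiscreteTopology B]
  [ContinuousSMul Λ B]
  (τ : ContinuousRep (GaloisGroupUnramifiedOutside K S) Λ A)
  (τ' : ContinuousRep (GaloisGroupUnramifiedOutside K S) Λ B)
  (u : A →L[Λ] B) (hu : ∀ (g : GaloisGroupUnramifiedOutside K S) (a : A), u (τ g a) = τ' g (u a))

omit [NumberField K] [ContinuousSMul Λ A] [ContinuousSMul Λ B] in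
/-- **`inf ∘ H¹(G_Σ, u|_{A^{N_Σ}}) = H¹(Γ_K, u) ∘ inf`** in degree `1`: inflation from `G_Σ = Γ_K/N_Σ`
commutes with the maps induced by a `G_Σ`-equivariant coefficient map `u : A → B` (on cocycles both
composites are `σ ↦ u (c (σ N_Σ))`). [cite: SerreGaloisCohomology1997, I §2.4] -/
theorem restrictedInf_map_invariantsHom (c : restrictedCohomology (toGaloisModule S τ) S 1) :
    (toGaloisModule S τ').restrictedInf S 1
        ((ContinuousCohomology.map (ContinuousMonoidHom.id (GaloisGroupUnramifiedOutside K S))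
          (ContinuousRep.invariantsHom (N := ramificationSubgroup K S)
            (toGaloisModuleHom S τ τ' u hu)) 1).hom c) =
      (cohomologyMap (toGaloisModuleHom S τ τ' u hu) 1).hom
        ((toGaloisModule S τ).restrictedInf S 1 c) := by
  obtain ⟨ψ, rfl⟩ := oneCocycleClass_surjective _ c
  change (ContinuousCohomology.map _ _ 1).hom ((ContinuousCohomology.map _ _ 1).hom _) =
    (ContinuousCohomology.map _ _ 1).hom ((ContinuousCohomology.map _ _ 1).hom _)
  erw [map_oneCocycleClass, map_oneCocycleClass, map_oneCocycleClass, map_oneCocycleClass]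
  exact congrArg _ (Subtype.ext (ContinuousMap.ext fun _ => rfl))

variable {D : Type} [AddCommGroup D] [Module Λ D] [TopologicalSpace D] [DiscreteTopology D]
  [ContinuousSMul Λ D] (ρ : ContinuousRep (GaloisGroupUnramifiedOutside K S) Λ D)
  {ι : Type*} (N : ι → Submodule Λ D)
  (hN : ∀ (i : ι) (g : GaloisGroupUnramifiedOutside K S), N i ≤ (N i).comap (ρ g))

/-- **Every class of `H¹(K_Σ/K, 𝐃)` is, after inflation to `Γ_K`, the image of an inflated class of
some level `N i`**: `inf x = (N i ⊆ 𝐃)_* (inf c)` with `c ∈ H¹(G_Σ, (N i)^{N_Σ})`, for a directed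
exhaustive family of stable submodules (`exists_Hmap_subtype_eq_one` read through
`restrictedHAddEquiv` / `Hmap_restrictedHAddEquiv` / `restrictedInf_map_invariantsHom`).
[cite: Greenberg2010, §3.1 p. 14] [cite: SerreGaloisCohomology1997, I §2.2 Prop. 8] -/
theorem exists_level_restrictedInf_eq (hdir : Directed (· ≤ ·) N) (hex : ∀ d : D, ∃ i, d ∈ N i)
    (x : ρ.H 1) :
    ∃ (i : ι) (c : restrictedCohomology
        (toGaloisModule S (ρ.subrepresentation (N i) (hN i))) S 1),
      (cohomologyMap (toGaloisModuleHom S (ρ.subrepresentation (N i) (hN i)) ρ (N i).subtypeL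
          (fun _ _ => rfl)) 1).hom
          ((toGaloisModule S (ρ.subrepresentation (N i) (hN i))).restrictedInf S 1 c) =
        (toGaloisModule S ρ).restrictedInf S 1 ((restrictedHAddEquiv S ρ 1).symm x) := by
  obtain ⟨i, x', hx'⟩ := exists_Hmap_subtype_eq_one S ρ N hN hdir hex x
  refine ⟨i, (restrictedHAddEquiv S (ρ.subrepresentation (N i) (hN i)) 1).symm x', ?_⟩
  rw [← restrictedInf_map_invariantsHom]
  congr 1
  apply (restrictedHAddEquiv S ρ 1).injective
  rw [AddEquiv.apply_symm_apply, ← Hmap_restrictedHAddEquiv, AddEquiv.apply_symm_apply, hx']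

omit [ContinuousSMul Λ D] in
/-- **Inflated level classes are unramified off `Σ`**: for a finite `v ∉ S`, the localisation of
`inf c`, `c ∈ H¹(G_Σ, (N i)^{N_Σ})`, lies in `H¹_ur(K_v, N i)` (the tree's
`localization_mem_unramifiedSubgroup_of_mem_range_restrictedInf`). [cite: MilneADT2006, Ch. I §4 (p. 55) and Lemma 4.8] -/
theorem localization_restrictedInf_mem_unramifiedSubgroup (i : ι)
    (c : restrictedCohomology (toGaloisModule S (ρ.subrepresentation (N i) (hN i))) S 1)
    {v : HeightOneSpectrum (𝓞 K)} (hv : v ∉ S) :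
    galoisCohomology.localization (toGaloisModule S (ρ.subrepresentation (N i) (hN i))) (Sum.inr v) 1
        ((toGaloisModule S (ρ.subrepresentation (N i) (hN i))).restrictedInf S 1 c) ∈
      unramifiedSubgroup (GaloisRep.toLocal v (toGaloisModule S (ρ.subrepresentation (N i) (hN i)))) 1 :=
  localization_mem_unramifiedSubgroup_of_mem_range_restrictedInf _ hv ⟨c, rfl⟩

end Literature.NumberTheory.IwasawaTheory.Greenberg2016
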